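import Mathlib.RingTheory.Grassmannian
import Mathlib.LinearAlgebra.TensorProduct.Pi
import HarnessLib

/-!
# The standard charts of the Grassmannian functor (rings side): `chart x A ⊆ G(k, A ⊗ M; A)`

Topic `Literature/AlgebraicGeometry/Motives` (next to ★ `FanoSchemeOfLines` / `GrassmannianOfLinesOverBase`); namespace
`Literature.AlgebraicGeometry.Motives`, declaration prefix `Grassmannian.`.  DEFINITIONS + their first API (no instance, no
notation, no `sorry`).  Cell hodgecm-mathlib, director s207 / B-plan1 (g15) 2026-08-30T02:00:09Z key (h4) «the Grassmannian as a
SCHEME from Mathlib `Module.Grassmannian.functor` + `Scheme.LocalRepresentability`» (author B-p21 (g15): Zariski sheaf +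
representability assembly; partner B-p18 (g17): charts + cover — this file; SEAM B-p21 02:03:21Z).  Count-neutral capital.

Mathlib's `Module.Grassmannian A (A ⊗[R] M) k` = `G(k, A ⊗ M; A)` ([Stacks 089R], EGA I (Springer) 9.7.3: submodules `N` whose
QUOTIENT is finite projective of constant rank `k`) and `Module.Grassmannian.map (f : A →ₐ[R] B)` (base change through
`baseChangeMkQ` / `baseChangeMkQEquiv`) give the covariant functor `Module.Grassmannian.functor R M k : CommAlgCat R ⥤ Type`; its
TODO list asks for the charts.  For a `k`-frame `x : Fin k → M` ([Stacks 089T], EGA I 9.7.4; Eisenbud–Harris §3.2.2 «the affine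
cover of the Grassmannian»):

* `Grassmannian.frameMap x N : (Fin k → A) →ₗ[A] (A ⊗[R] M) ⧸ N` — `eᵢ ↦ [1 ⊗ xᵢ]`;
* `Grassmannian.chart x A := {N : G(k, A ⊗ M; A) | frameMap x N bijective}` — the standard chart «the `x`-minor is invertible»;
* `Grassmannian.frameMap_map_eq` — under `baseChangeMkQEquiv`, the frame map of `map f N` is the base change of the frame map of
  `N`; hence **`Grassmannian.map_mem_chart`**: `chart x` is a SUBFUNCTOR of the Grassmannian functor.

Sequels: `GrassmannianChartAffine` (`chart x A ≃ {ψ : M →ₗ[R] (Fin k → A) // ψ ∘ x = e}` naturally in `A`, i.e. `chart x ≅ 𝔸^{k(n−k)}`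
for `M = Rⁿ`), `GrassmannianChartsCover` (the charts cover the field-valued points), and B-p21 (g15)'s `GrassmannianZariskiSheaf` /
scheme assembly.  HC_CM is proved only modulo the 7 printed citations until rung 0 closes; nothing here is about HC.

## References
* [StacksProject, Tag 089R and Tag 089T] (the Grassmannian functor and its standard open cover).
* [EisenbudHarris2016] D. Eisenbud, J. Harris, *3264 and All That* (2016), §3.2.2 (affine cover of the Grassmannian).
* A. Grothendieck, EGA I (Springer 1971), §9.7.3–9.7.4.
-/

set_option autoImplicit false

noncomputable section

universe u v w

open TensorProduct

namespace Literature.AlgebraicGeometry.Motives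

namespace Grassmannian

variable {R : Type u} [CommRing R] {M : Type v} [AddCommGroup M] [Module R M] {k : ℕ}
variable {A : Type w} [CommRing A] [Algebra R A] {B : Type w} [CommRing B] [Algebra R B]

/-! ## §1 The frame map and the chart -/

/-- **The frame map of a submodule `N ≤ A ⊗[R] M` at the frame `x : Fin k → M`**: the `A`-linear map `Aᵏ → (A ⊗ M)⧸N`,
`eᵢ ↦ [1 ⊗ xᵢ]` (the composite `Aᵏ → A ⊗ M → (A ⊗ M)⧸N` of Mathlib's TODO «`chart x`»). [cite: StacksProject, Tag 089T] -/
def frameMap (x : Fin k → M) (N : Submodule A (A ⊗[R] M)) : (Fin k → A) →ₗ[A] (A ⊗[R] M) ⧸ N :=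
  Fintype.linearCombination A (fun i => N.mkQ ((1 : A) ⊗ₜ[R] x i))

/-- The frame map on a basis vector: `frameMap x N eᵢ = [1 ⊗ xᵢ]`. [cite: StacksProject, Tag 089T] -/
theorem frameMap_single (x : Fin k → M) (N : Submodule A (A ⊗[R] M)) (i : Fin k) :
    frameMap x N (Pi.single i 1) = N.mkQ ((1 : A) ⊗ₜ[R] x i) := by
  classical
  rw [frameMap, Fintype.linearCombination_apply_single, one_smul]

/-- The frame map on a general vector: `frameMap x N a = Σᵢ aᵢ • [1 ⊗ xᵢ] = [Σᵢ aᵢ ⊗ xᵢ]`. [cite: StacksProject, Tag 089T] -/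
theorem frameMap_apply (x : Fin k → M) (N : Submodule A (A ⊗[R] M)) (a : Fin k → A) :
    frameMap x N a = N.mkQ (∑ i, a i ⊗ₜ[R] x i) := by
  rw [frameMap, Fintype.linearCombination_apply, map_sum]
  refine Finset.sum_congr rfl fun i _ => ?_
  rw [← map_smul, TensorProduct.smul_tmul', smul_eq_mul, mul_one]

variable (R M k) in
/-- **The standard chart of the Grassmannian functor at the frame `x`**: the set of `N ∈ G(k, A ⊗ M; A)` whose frame map
`Aᵏ → (A ⊗ M)⧸N` is BIJECTIVE («the `x`-minor is invertible»; Mathlib's TODO «`chart x`»).  For `M = Rⁿ` and `x` a sub-frame of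
the standard basis this is the classical affine chart `U_I ≅ 𝔸^{k(n−k)}`. [cite: StacksProject, Tag 089T]
[cite: EisenbudHarris2016, §3.2.2] -/
def chart (x : Fin k → M) (A : Type w) [CommRing A] [Algebra R A] : Set (Module.Grassmannian A (A ⊗[R] M) k) :=
  {N | Function.Bijective (frameMap x N.toSubmodule)}

/-- Membership in the chart, unfolded. [cite: StacksProject, Tag 089T] -/
theorem mem_chart_iff (x : Fin k → M) (N : Module.Grassmannian A (A ⊗[R] M) k) :
    N ∈ chart R M k x A ↔ Function.Bijective (frameMap x N.toSubmodule) :=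
  Iff.rfl

/-- On the chart, the frame map is a linear equivalence `Aᵏ ≃ (A ⊗ M)⧸N` (non-Prop plumbing). [cite: StacksProject, Tag 089T] -/
def frameEquiv (x : Fin k → M) (N : Module.Grassmannian A (A ⊗[R] M) k) (hN : N ∈ chart R M k x A) :
    (Fin k → A) ≃ₗ[A] (A ⊗[R] M) ⧸ N.toSubmodule :=
  LinearEquiv.ofBijective (frameMap x N.toSubmodule) hN

/-- The frame equivalence is the frame map. [cite: StacksProject, Tag 089T] -/
@[simp]
theorem frameEquiv_apply (x : Fin k → M) (N : Module.Grassmannian A (A ⊗[R] M) k) (hN : N ∈ chart R M k x A)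
    (a : Fin k → A) : frameEquiv x N hN a = frameMap x N.toSubmodule a :=
  rfl

/-! ## §2 The chart is a subfunctor: stability under `Module.Grassmannian.map` -/

/-- **The frame map of `map f N` is the base change of the frame map of `N`**, read through Mathlib's
`baseChangeMkQEquiv : (B ⊗ M)⧸(map f N) ≃ B ⊗[A] ((A ⊗ M)⧸N)`: for every `i`,
`baseChangeMkQEquiv [1 ⊗ xᵢ] = 1 ⊗ [1 ⊗ xᵢ]`. [cite: StacksProject, Tag 089R] -/
theorem baseChangeMkQEquiv_frameMap_single (f : A →ₐ[R] B) (x : Fin k → M) (N : Module.Grassmannian A (A ⊗[R] M) k)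
    (i : Fin k) :
    letI : Algebra A B := f.toAlgebra
    letI : IsScalarTower R A B := IsScalarTower.of_algHom f
    (Module.Grassmannian.baseChangeMkQEquiv (B := B) N.toSubmodule)
        (Submodule.quotEquivOfEq _ _ (Module.Grassmannian.map_toSubmodule f N)
          (frameMap x (Module.Grassmannian.map f N).toSubmodule (Pi.single i 1))) =
      (1 : B) ⊗ₜ[A] frameMap x N.toSubmodule (Pi.single i 1) := by
  letI : Algebra A B := f.toAlgebra
  letI : IsScalarTower R A B := IsScalarTower.of_algHom f
  rw [frameMap_single, frameMap_single]
  change (Module.Grassmannian.baseChangeMkQ B N.toSubmodule).quotKerEquivOfSurjective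
      (Module.Grassmannian.baseChangeMkQ_surjective N.toSubmodule)
      (Submodule.Quotient.mk ((1 : B) ⊗ₜ[R] x i)) = _
  rw [LinearMap.quotKerEquivOfSurjective_apply_mk]
  change (N.toSubmodule.mkQ.baseChange B) ((AlgebraTensorModule.cancelBaseChange R A B B M).symm ((1 : B) ⊗ₜ[R] x i)) = _
  rw [AlgebraTensorModule.cancelBaseChange_symm_tmul, LinearMap.baseChange_tmul]

/-- **The chart is a SUBFUNCTOR of the Grassmannian functor**: `N ∈ chart x A ⟹ map f N ∈ chart x B` for every `R`-algebra map
`f : A → B` — the frame map of `map f N` is, up to the linear equivalences `Bᵏ ≅ B ⊗[A] Aᵏ` (Mathlib `TensorProduct.piScalarRight`)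
and `(B ⊗ M)⧸(map f N) ≅ B ⊗[A] ((A ⊗ M)⧸N)` (Mathlib `baseChangeMkQEquiv`), the base change `B ⊗[A] (frameMap x N)` of a
bijection. [cite: StacksProject, Tag 089T] [cite: EisenbudHarris2016, §3.2.2] -/
theorem map_mem_chart (f : A →ₐ[R] B) {x : Fin k → M} {N : Module.Grassmannian A (A ⊗[R] M) k}
    (hN : N ∈ chart R M k x A) : Module.Grassmannian.map f N ∈ chart R M k x B := by
  classical
  letI : Algebra A B := f.toAlgebra
  letI : IsScalarTower R A B := IsScalarTower.of_algHom f
  -- the three linear equivalences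
  let E : ((B ⊗[R] M) ⧸ (Module.Grassmannian.map f N).toSubmodule) ≃ₗ[B]
      B ⊗[A] ((A ⊗[R] M) ⧸ N.toSubmodule) :=
    (Submodule.quotEquivOfEq _ _ (Module.Grassmannian.map_toSubmodule f N)).trans
      (Module.Grassmannian.baseChangeMkQEquiv (B := B) N.toSubmodule)
  let ι : (Fin k → B) ≃ₗ[B] B ⊗[A] (Fin k → A) := (TensorProduct.piScalarRight A B B (Fin k)).symm
  let eN : B ⊗[A] (Fin k → A) ≃ₗ[B] B ⊗[A] ((A ⊗[R] M) ⧸ N.toSubmodule) := (frameEquiv x N hN).baseChange A B _ _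
  -- the frame map of `map f N` is `E⁻¹ ∘ eN ∘ ι`
  have key : frameMap x (Module.Grassmannian.map f N).toSubmodule =
      (ι.trans (eN.trans E.symm)).toLinearMap := by
    refine (Pi.basisFun B (Fin k)).ext fun i => ?_
    rw [Pi.basisFun_apply, LinearEquiv.coe_coe, LinearEquiv.trans_apply, LinearEquiv.trans_apply,
      LinearEquiv.eq_symm_apply]
    change E (frameMap x (Module.Grassmannian.map f N).toSubmodule (Pi.single i 1)) = eN (ι (Pi.single i 1))
    have h1 : ι (Pi.single i 1) = (1 : B) ⊗ₜ[A] (Pi.single i 1 : Fin k → A) :=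
      TensorProduct.piScalarRight_symm_single (R := A) (S := B) (N := B) (ι := Fin k) 1 i
    rw [h1]
    change _ = ((frameEquiv x N hN).baseChange A B _ _) ((1 : B) ⊗ₜ[A] (Pi.single i 1 : Fin k → A))
    rw [LinearEquiv.baseChange_tmul, frameEquiv_apply]
    exact baseChangeMkQEquiv_frameMap_single f x N i
  rw [mem_chart_iff, key]
  exact (ι.trans (eN.trans E.symm)).bijective

end Grassmannian

end Literature.AlgebraicGeometry.Motives

end
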